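import Mathlib
import Summits.NavierStokesRegularity.Statement
import Literature.Analysis.FluidPDE.ClassicalSolution
import Literature.Analysis.FluidPDE.LerayHopf
import Literature.Analysis.FluidPDE.NSWave0
import Literature.Analysis.FluidPDE.NSLerayHopf

/-!
# NavierStokesRegularity — route `Blowup`, glue of the `X5b` branch

Settles `stmt-NavierStokesRegularity-0724` (positive, formal glue): Clay-class uniqueness `X5b`
(`stmt-NavierStokesRegularity-0153`) from
* (b1) `stmt-…-0722`: a Clay-class solution (jointly smooth on `ℝ³ × [0,∞)`, bounded energy)
  from a rapidly decaying datum is Leray–Hopf on every `[0, T]`;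
* (b2) `stmt-…-0723`: a classical Leray–Hopf solution on `[0, T)` from a rapidly decaying datum
  is bounded on `(0, T') × ℝ³` for every `T' < T` (Serrin class `r = ∞`);
* the named fact `Literature.Analysis.FluidPDE.weak_strong_uniqueness` (Prodi 1959; Serrin 1963, Thm. 6);
* time restriction of Leray–Hopf solutions (shape of `Literature.Analysis.FluidPDE.IsLerayHopfOn.mono`).
Proof: for `t ∈ (0, T)` take `T' = (t + T)/2`, compare on `[0, T']` by weak–strong uniqueness
(a.e.), and upgrade to equality of the continuous slices (Lebesgue measure is positive on
opens); `t = 0` from the initial conditions.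
-/

open Set MeasureTheory
open scoped ContDiff

namespace Literature.NS

/-- Time slices of a field smooth on the closed half-space are continuous. [folklore] -/
theorem _root_.Literature.Analysis.FluidPDE.IsSmoothOnHalfSpace.continuous_slice
    {u : ℝ → EuclideanSpace ℝ (Fin 3) → EuclideanSpace ℝ (Fin 3)}
    (hu : Literature.Analysis.FluidPDE.IsSmoothOnHalfSpace u) {t : ℝ} (ht : 0 ≤ t) : Continuous (u t) := by
  have hc : ContDiff ℝ ∞ (fun x : EuclideanSpace ℝ (Fin 3) => ((t, x) : ℝ × EuclideanSpace ℝ (Fin 3))) :=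
    contDiff_const.prodMk contDiff_id
  have := hu.comp_contDiff hc (fun x => mk_mem_prod (mem_Ici.2 ht) (mem_univ x))
  have h2 : ContDiff ℝ ∞ (u t) := by simpa [Function.comp_def, Function.uncurry] using this
  exact h2.continuous

/-- Settles stmt-NavierStokesRegularity-0724: glue of the `X5b` branch of route `Blowup` —
(b1) Clay-class ⇒ Leray–Hopf, (b2) classical Leray–Hopf ⇒ bounded on sub-strips,
weak–strong uniqueness and time restriction give Clay-class uniqueness `X5b`.
[folklore; Prodi 1959, Serrin 1963 Thm. 6, Robinson–Rodrigo–Sadowski 2016 Thm. 8.19] -/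
theorem blowup_X5b_glue :
    (∀ ν : ℝ, 0 < ν → ∀ (u₀ : EuclideanSpace ℝ (Fin 3) → EuclideanSpace ℝ (Fin 3)), Literature.Analysis.FluidPDE.HasRapidSpatialDecay u₀ → ∀ (u : ℝ → EuclideanSpace ℝ (Fin 3) → EuclideanSpace ℝ (Fin 3)) (p : ℝ → EuclideanSpace ℝ (Fin 3) → ℝ), Literature.Analysis.FluidPDE.IsSmoothOnHalfSpace u → Literature.Analysis.FluidPDE.IsSmoothOnHalfSpace p → Literature.Analysis.FluidPDE.IsNavierStokesSolution ν 0 u₀ u p → Literature.Analysis.FluidPDE.HasBoundedEnergy u → ∀ T : ℝ, 0 < T → Literature.Analysis.FluidPDE.IsLerayHopfOn T ν 0 u₀ u) → (∀ (ν T : ℝ), 0 < ν → 0 < T → ∀ (u : ℝ → EuclideanSpace ℝ (Fin 3) → EuclideanSpace ℝ (Fin 3)) (p : ℝ → EuclideanSpace ℝ (Fin 3) → ℝ), Literature.Analysis.FluidPDE.IsClassicalNSSolutionOn (Set.Ico 0 T) ν 0 u p → Literature.Analysis.FluidPDE.IsLerayHopfOn T ν 0 (u 0) u → Literature.Analysis.FluidPDE.HasRapidSpatialDecay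 (u 0) → ∀ T' ∈ Set.Ioo 0 T, Literature.Analysis.FluidPDE.MemLqLp ⊤ ⊤ u (Set.Ioo 0 T')) → Literature.Analysis.FluidPDE.weak_strong_uniqueness → (∀ (T T' ν : ℝ) (u₀ : EuclideanSpace ℝ (Fin 3) → EuclideanSpace ℝ (Fin 3)) (u : ℝ → EuclideanSpace ℝ (Fin 3) → EuclideanSpace ℝ (Fin 3)), Literature.Analysis.FluidPDE.IsLerayHopfOn T ν 0 u₀ u → 0 < T' → T' ≤ T → Literature.Analysis.FluidPDE.IsLerayHopfOn T' ν 0 u₀ u) → (∀ ν : ℝ, 0 < ν → ∀ (u₀ : EuclideanSpace ℝ (Fin 3) → EuclideanSpace ℝ (Fin 3)), Literature.Analysis.FluidPDE.HasRapidSpatialDecay u₀ → ∀ (u v : ℝ → EuclideanSpace ℝ (Fin 3) → EuclideanSpace ℝ (Fin 3)) (p q : ℝ → EuclideanSpace ℝ (Fin 3) → ℝ) (T : ℝ), 0 < T → Literature.Analysis.FluidPDE.IsSmoothOnHalfSpace u → Literature.Analysis.FluidPDE.IsSmoothOnHalfSpace p → Literature.Analysis.FluidPDE.IsNavierStokesSolution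 ν 0 u₀ u p → Literature.Analysis.FluidPDE.HasBoundedEnergy u → Literature.Analysis.FluidPDE.IsClassicalNSSolutionOn (Set.Ico 0 T) ν 0 v q → Literature.Analysis.FluidPDE.IsLerayHopfOn T ν 0 u₀ v → v 0 = u₀ → ∀ t ∈ Set.Ico 0 T, u t = v t) := by
  intro hb1 hb2 hwsu hmono ν hν u₀ hdec u v p q T hT hu hp hns hbe hcl hvLH hv0 t ht
  rcases eq_or_lt_of_le ht.1 with h0 | htpos
  · subst h0
    rw [hns.initial, hv0]
  · set T' : ℝ := (t + T) / 2 with hT'def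
    have htT' : t < T' := by rw [hT'def]; linarith [ht.2]
    have hT'T : T' < T := by rw [hT'def]; linarith [ht.2]
    have hT'pos : 0 < T' := htpos.trans htT'
    have huLH : Literature.Analysis.FluidPDE.IsLerayHopfOn T' ν 0 u₀ u := hb1 ν hν u₀ hdec u p hu hp hns hbe T' hT'pos
    have hvLH' : Literature.Analysis.FluidPDE.IsLerayHopfOn T' ν 0 u₀ v := hmono T T' ν u₀ v hvLH hT'pos hT'T.le
    have hvLH0 : Literature.Analysis.FluidPDE.IsLerayHopfOn T ν 0 (v 0) v := hv0.symm ▸ hvLH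
    have hdec0 : Literature.Analysis.FluidPDE.HasRapidSpatialDecay (v 0) := hv0.symm ▸ hdec
    have hS : Literature.Analysis.FluidPDE.MemLqLp ⊤ ⊤ v (Set.Ioo 0 T') := hb2 ν T hν hT v q hcl hvLH0 hdec0 T' ⟨hT'pos, hT'T⟩
    have hae : u t =ᵐ[volume] v t :=
      hwsu hν hT'pos hvLH' (q := ⊤) (r := ⊤) (by simp) (by simp) hS huLH t ⟨htpos, htT'.le⟩
    have hcu : Continuous (u t) := hu.continuous_slice ht.1
    have hcv : Continuous (v t) := (hcl.contDiff_velocity ht).continuous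
    exact (hcu.ae_eq_iff_eq volume hcv).1 hae

end Literature.NS
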